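import Summits.BirchSwinnertonDyer.BirchSwinnertonDyer.Theorems.ResidualThetaTransportAtTwoPlusHonestLayerCount
import Summits.BirchSwinnertonDyer.BirchSwinnertonDyer.Theorems.ResidualThetaTransportAtTwoPlusOmegaAnnihilation
import Summits.BirchSwinnertonDyer.BirchSwinnertonDyer.Theorems.ResidualThetaTransportAtTwoPlusDualIsoLambdaTwo
import HarnessLib

/-!
# (d′) at `p = 2`: the HONEST plus classes of an even layer fill the `ω⁺`-torsion of the realization —
# `ι_J(E⁺(ℚ_{2,2m})) = S[2^J, ω⁺_{2m}(φ−1)] = ω̃⁻_{2m}(φ−1)·S[2^J, ω_{2m}(φ−1)]` (Kim 2007 Prop. 3.15 step (b)+(c) at 2), UNCONDITIONAL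
# for `GoodSS W 2`, `a₂ = 0`, in the realization currency of (R1)@2

Routes `ResidualThetaTransportAtTwo` (RTT, crux r201 `ResidualLambdaFormulaNegDiscAtTwo`, stmt-BirchSwinnertonDyer-23110) /
`ThetaPartnerAtTwo`. Seat `prover-bsd-wall-tp2-p2x-w3` g13; `--supports stmt-BirchSwinnertonDyer-23110 --as helper` (brick (d′) of the ISO /
H-PLUSDUAL θ-plan: «honest layer Kummer classes ⊇ ω̃⁻_n·H_n for even n», w2 g15/g16, lead g12 21:28Z). THEOREMS ONLY (no definition,
no named fact, no instance, no `sorry`); closes nothing.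

SETTING = the hypotheses of `PlusDualTwo.nonempty_linearEquiv_iwasawaAlgebra_two` VERBATIM: `W/ℚ` globally minimal, `GoodSS W 2`,
`a₂(W) = 0`, `κ` cyclotomic, `v ∋ 2`, `g ∈ Γ_{ℚ_v}` a local lift of the topological generator, `A = ⨆ₙ E⁺(ℚ_{2,n})`
(`signedLocalPoints κ ℚ_v W 1 n`), a realization `(S, φ, ι_k)` of `A ⊗ ℚ₂/ℤ₂` (`ι 0 = 0`, `2 ι_{k+1} = ι_k`, `S = ⋃ im ι_k`,
`ker ι_k = 2^k A`, `φ ∘ ι_k = ι_k ∘ g`) and a dual pair `IsDualPair 2 (φ − 1) toDual`. B. D. Kim, Compositio 143 (2007), proof of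
Prop. 3.15, step (b): «`ω⁻_n Ê⁻(m_n) = 0`, thus `Ê⁻(m_n) ⊗ ℚ_p/ℤ_p ⊂ H⁻_n[ω⁻_n]`; both have corank `d·deg ω⁻_n` and are divisible, thus
equal»; here, PLUS side at `p = 2`, FINITE level `2^J`, exact counts instead of coranks:
* `iota_image_subset` — ANNIHILATION: `ι_J(E⁺(ℚ_{2,n})) ⊆ {s : 2^J s = 0, ω⁺_n(φ−1) s = 0}` (`SignedEC.PlusOmega.aeval_X_mul_cyclotomic
  OmegaPlus_apply_eq_zero` transported by `aeval_sub_one_apply_iota`; (NT)@2 = `SSFlatEC.eq_zero_of_mem_localTowerPointsOfEmb_of_two_nsmul`);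
* `exists_indep_signedLocalPoints_even` — RANK: `deg(T·ω̃⁺_{2m}) = 4^m − deg ω̃⁻_{2m}` points of `E⁺(ℚ_{2,2m})` independent modulo
  `2·E(ℚ_{2,∞}·ℚ_v)` (`SignedEC.PlusRankGrowth.forall_dvd_of_onto` + `SignedColemanImage.hondaPlus_onto_two`, the maximal `R` allowed by `e + R ≤ 4^m`);
* **`iota_image_eq_torsionBy_omegaPlus`** — `{ι_J x : x ∈ E⁺(ℚ_{2,2m})} = {s : 2^J s = 0, (T·ω̃⁺_{2m})(φ−1) s = 0}` (counting shell
  `eq_torsionBy_ker_of_subset_of_le_ncard` with `#S[2^J, D(φ−1)] = 2^{J deg D}` from (R1)@2 and `le_ncard_of_indep`);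
* **`iota_image_eq_image_omegaMinus`** — `= ω̃⁻_{2m}(φ−1) '' {s : 2^J s = 0, ω_{2m}(φ−1) s = 0}` (Kim (c), `image_aeval_cyclotomicOmegaMinus_eq`).

HONEST FRAMING: closes nothing; ISO / `hdual_Alt` / 23110 NOT proved; BSD is not proved by any of this.
References: [BDKim2007] Prop. 3.14, Prop. 3.15 (proof, p. 56), Prop. 3.17; [Kobayashi2003] Thm. 6.2, Prop. 8.12, Prop. 8.23; [Pollack2003] §6.5.
-/

set_option autoImplicit false
-- D-0017: single-problem summit, so `Summit.BirchSwinnertonDyer.BirchSwinnertonDyer.…` repeats a namespace BY DESIGN.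
set_option linter.dupNamespace false

noncomputable section

open scoped Classical NumberField
open Polynomial Finset Literature.NumberTheory.EllipticCurves Literature.NumberTheory.EllipticCurves.IwasawaDual

namespace Summit.BirchSwinnertonDyer.BirchSwinnertonDyer.Theorems.ResidualThetaLayer.PlusDual

open Literature.NumberTheory.GaloisRepresentations WeierstrassCurve ZpExtension
  Literature.NumberTheory.EllipticCurves.Kobayashi2003 Literature.NumberTheory.EllipticCurves.Sprung2012
  Summit.BirchSwinnertonDyer.Rank1Residual.Additive NumberField IsDedekindDomain
  Summit.BirchSwinnertonDyer.BirchSwinnertonDyer.Theorems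

variable (W : WeierstrassCurve ℚ) [W.IsElliptic] [W.IsGloballyMinimal]

/-! ## §1 Degrees: `deg ω̃⁻_n` is the degree of the odd cyclotomic product used by `forall_dvd_of_onto` -/

omit [W.IsElliptic] [W.IsGloballyMinimal] in
/-- `deg ω̃⁻_n = deg (∏_{1≤2k−1≤n} Φ_{p^{2k−1}})` (the `X ↦ X+1` shift and the base change `ℤ → ℤ_p` preserve degrees). [folklore] -/
theorem natDegree_cyclotomicOmegaMinus_eq (p : ℕ) [Fact p.Prime] (n : ℕ) :
    (cyclotomicOmegaMinus p n).natDegree =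
      ((∏ k ∈ Icc 1 ((n + 1) / 2), cyclotomic (p ^ (2 * k - 1)) ℤ).map (Int.castRingHom ℤ_[p])).natDegree := by
  have hq : (X + 1 : ℤ[X]).Monic := by simpa using monic_X_add_C (1 : ℤ)
  have hqdeg : (X + 1 : ℤ[X]).natDegree = 1 := by simpa using natDegree_X_add_C (1 : ℤ)
  rw [natDegree_map_eq_of_injective (RingHom.injective_int (Int.castRingHom ℤ_[p])), cyclotomicOmegaMinus,
    natDegree_prod_of_monic _ _ (fun k _ ↦ (cyclotomic.monic _ ℤ).comp hq (by rw [hqdeg]; exact one_ne_zero)),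
    natDegree_prod_of_monic _ _ (fun k _ ↦ cyclotomic.monic _ ℤ)]
  refine Finset.sum_congr rfl fun k _ ↦ ?_
  rw [natDegree_comp, hqdeg, mul_one]

/-! ## §2 RANK at the even layers: `deg(T·ω̃⁺_{2m})` independent plus points -/

/-- **Exact rank input at an even layer.** For `W/ℚ` globally minimal with `GoodSS W 2`, `a₂(W) = 0`, cyclotomic `κ`, `v ∋ 2`: there are
`R = deg(T·ω̃⁺_{2m}) = 4^m − deg ω̃⁻_{2m}` points of `E⁺(ℚ_{2,2m})` linearly independent modulo `2·E(ℚ_{2,∞}·ℚ_v)` (the points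
`g^{e+i} d_{2m}`, `i < R`, `e = deg ω̃⁻_{2m}`, of a plus Honda family, by `Col⁺` ONTO: `SignedEC.PlusRankGrowth.forall_dvd_of_onto` with the maximal
`R` allowed by `e + R ≤ 4^m`). [cite: Kobayashi2003, Thm. 6.2, Prop. 8.23] [cite: BDKim2007, Prop. 3.15 («corank … = d·deg ω_n»)] -/
theorem exists_indep_signedLocalPoints_even (hss : Rank1Residual.GoodSS W 2) (ha : W.frobeniusTrace 2 = 0)
    (κ : ZpExtension ℚ 2) (hκ : κ.IsCyclotomic) (v : HeightOneSpectrum (𝓞 ℚ)) (hv : (2 : 𝓞 ℚ) ∈ v.asIdeal) (m : ℕ) :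
    ∃ x : Fin ((X * cyclotomicOmegaPlus 2 (2 * m)).natDegree) → localPoints W (v.adicCompletion ℚ),
      (∀ i, x i ∈ signedLocalPoints κ (v.adicCompletion ℚ) W 1 (2 * m)) ∧
      ∀ (c : Fin ((X * cyclotomicOmegaPlus 2 (2 * m)).natDegree) → ℤ),
        ∀ y ∈ Sprung2012.localTowerPointsOfEmb κ (closureEmb (K := ℚ) (v.adicCompletion ℚ)) W,
          ∑ i, c i • x i = 2 • y → ∀ i, (2 : ℤ) ∣ c i := by
  set ι := closureEmb (K := ℚ) (v.adicCompletion ℚ) with hι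
  obtain ⟨g, d, -, hL, hTR, -, honto⟩ := SignedColemanImage.hondaPlus_onto_two W hss ha κ hκ v hv
  set Q : ℤ_[2][X] := (∏ k ∈ Icc 1 ((2 * m + 1) / 2), cyclotomic (2 ^ (2 * k - 1)) ℤ).map (Int.castRingHom ℤ_[2]) with hQ
  set e := Q.natDegree with he
  set R := (X * cyclotomicOmegaPlus 2 (2 * m)).natDegree with hR
  have heR : e + R ≤ 2 ^ (2 * m) := by
    have h1 := natDegree_X_mul_cyclotomicOmegaPlus_add 2 (2 * m)
    have h2 := natDegree_cyclotomicOmegaMinus_eq 2 (2 * m)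
    rw [← hQ] at h2
    omega
  -- `Γ`-stability of the plus points and of the tower
  have hstab : ∀ (n : ℕ) (σ : Field.absoluteGaloisGroup (v.adicCompletion ℚ)),
      ∀ a ∈ signedLocalPointsOfEmb κ ι W 1 n, σ • a ∈ signedLocalPointsOfEmb κ ι W 1 n := by
    intro n σ a ha'
    rw [signedLocalPointsOfEmb_eq_towerSigned] at ha' ⊢
    exact smul_mem_towerSignedLocalPointsOfEmb κ.layerSubgroup ι W 1 n σ ha'
  have hd2m : d (2 * m) ∈ signedLocalPointsOfEmb κ ι W 1 (2 * m) :=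
    SignedEC.d_even_mem_signedLocalPointsOfEmb_one W κ ι d hL hTR m
  have hpow : ∀ j : ℕ, g ^ j • d (2 * m) ∈ signedLocalPointsOfEmb κ ι W 1 (2 * m) := by
    intro j
    induction j with
    | zero => simpa using hd2m
    | succ j ih => rw [pow_succ', mul_smul]; exact hstab _ g _ ih
  have hA : ∀ j : ℕ, g ^ j • d (2 * m) ∈ Sprung2012.localTowerPointsOfEmb κ ι W := fun j ↦
    Sprung2012.localLayerPointsOfEmb_le_localTowerPointsOfEmb κ ι W (2 * m)
      (((mem_signedLocalPointsOfEmb_iff κ ι W 1 (2 * m) _).1 (hpow j)).1)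
  refine ⟨fun i ↦ g ^ (e + i) • d (2 * m), fun i ↦ hpow _, fun c y hy hrel ↦ ?_⟩
  have h := SignedEC.PlusRankGrowth.forall_dvd_of_onto (p := 2) W (Sprung2012.localTowerPointsOfEmb κ ι W) g (2 * m) (d (2 * m)) hA
    (honto m) (R := R) heR c hy
  exact h (by exact_mod_cast hrel)

/-! ## §3 The honest classes of an even layer -/

section Honest

variable {S : Type*} [AddCommGroup S] {φ : AddMonoid.End S}
variable {Xd : Type*} [AddCommGroup Xd] [Module (PowerSeries ℤ_[2]) Xd] {toDual : Xd →+ (S →+ AddCircle (1 : ℚ))}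

/-- **ANNIHILATION transported: `ι_J(E⁺(ℚ_{2,n})) ⊆ {s : 2^J s = 0, (T·ω̃⁺_n)(φ−1) s = 0}`** for every realization `(S, φ, ι_k)` of
`(⋃ₙE⁺(ℚ_{2,n})) ⊗ ℚ₂/ℤ₂` (Kim 3.14 for plus points, `SignedEC.PlusOmega.aeval_X_mul_cyclotomicOmegaPlus_apply_eq_zero`, through
`aeval_sub_one_apply_iota`; no `2`-torsion in the tower by `SSFlatEC.eq_zero_of_mem_localTowerPointsOfEmb_of_two_nsmul`).
[cite: BDKim2007, Prop. 3.14, Prop. 3.15 (proof: «thus `Ê(m_n) ⊗ ℚ_p/ℤ_p ⊂ H_n[ω_n]`»)] -/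
theorem iota_image_subset (hss : Rank1Residual.GoodSS W 2) {κ : ZpExtension ℚ 2} (v : HeightOneSpectrum (𝓞 ℚ))
    (hv : (2 : 𝓞 ℚ) ∈ v.asIdeal) {g : Field.absoluteGaloisGroup (v.adicCompletion ℚ)}
    (hg : κ.IsTopGenerator (resGalOfEmb (closureEmb (K := ℚ) (v.adicCompletion ℚ)) g))
    (ι : ℕ → (↥(⨆ n, signedLocalPoints κ (v.adicCompletion ℚ) W 1 n) →+ S))
    (h0 : ∀ x, ι 0 x = 0) (hsucc : ∀ (k : ℕ) x, 2 • ι (k + 1) x = ι k x)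
    (hequiv : ∀ (k : ℕ) (x : ↥(⨆ n, signedLocalPoints κ (v.adicCompletion ℚ) W 1 n)),
      φ (ι k x) = ι k ⟨g • (x : localPoints W (v.adicCompletion ℚ)), SignedEC.PlusDualTwo.smul_mem_iSup_signedLocalPoints W κ v g x.2⟩)
    (n J : ℕ) :
    {s : S | ∃ x : ↥(⨆ n, signedLocalPoints κ (v.adicCompletion ℚ) W 1 n),
        (x : localPoints W (v.adicCompletion ℚ)) ∈ signedLocalPoints κ (v.adicCompletion ℚ) W 1 n ∧ ι J x = s} ⊆
      {s : S | 2 ^ J • s = 0 ∧ Polynomial.aeval (φ - 1) (X * cyclotomicOmegaPlus 2 n) s = 0} := by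
  rintro _ ⟨x, hx, rfl⟩
  set ιe := closureEmb (K := ℚ) (v.adicCompletion ℚ) with hιe
  have hnt : ∀ P ∈ localTowerPointsOfEmb κ ιe W, 2 • P = 0 → P = 0 :=
    fun P hP h2 ↦ SSFlatEC.eq_zero_of_mem_localTowerPointsOfEmb_of_two_nsmul W hss κ (by exact_mod_cast hv) _ hP h2
  refine ⟨pow_nsmul_iota_eq_zero _ ι h0 hsucc J x, ?_⟩
  rw [aeval_sub_one_apply_iota (DistribMulAction.toAddMonoidEnd (Field.absoluteGaloisGroup (v.adicCompletion ℚ))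
    (localPoints W (v.adicCompletion ℚ)) g) _ φ (ι J) (fun a ha ↦ SignedEC.PlusDualTwo.smul_mem_iSup_signedLocalPoints W κ v g ha)
    (fun x ↦ hequiv J x) (X * cyclotomicOmegaPlus 2 n) x]
  have h0' : Polynomial.aeval ((DistribMulAction.toAddMonoidEnd (Field.absoluteGaloisGroup (v.adicCompletion ℚ))
      (localPoints W (v.adicCompletion ℚ)) g) - 1) (X * cyclotomicOmegaPlus 2 n) (x : localPoints W (v.adicCompletion ℚ)) = 0 :=
    SignedEC.PlusOmega.aeval_X_mul_cyclotomicOmegaPlus_apply_eq_zero W κ ιe hnt hg n hx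
  have hmem := aeval_sub_one_mem (DistribMulAction.toAddMonoidEnd (Field.absoluteGaloisGroup (v.adicCompletion ℚ))
    (localPoints W (v.adicCompletion ℚ)) g) (⨆ n, signedLocalPoints κ (v.adicCompletion ℚ) W 1 n)
    (fun a ha ↦ SignedEC.PlusDualTwo.smul_mem_iSup_signedLocalPoints W κ v g ha) (X * cyclotomicOmegaPlus 2 n) x.2
  have hzero : (⟨Polynomial.aeval ((DistribMulAction.toAddMonoidEnd (Field.absoluteGaloisGroup (v.adicCompletion ℚ))
      (localPoints W (v.adicCompletion ℚ)) g) - 1) (X * cyclotomicOmegaPlus 2 n) (x : localPoints W (v.adicCompletion ℚ)), hmem⟩ :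
        ↥(⨆ n, signedLocalPoints κ (v.adicCompletion ℚ) W 1 n)) = 0 := Subtype.ext h0'
  show ι J ⟨_, hmem⟩ = 0
  rw [hzero, map_zero]

/-- **Kim's step (b) at `2`, plus side, finite level: the honest classes FILL the `ω⁺`-torsion.** In the setting of (R1)@2
(`PlusDualTwo.nonempty_linearEquiv_iwasawaAlgebra_two`, hypotheses verbatim) and for every `m, J`:
`{ι_J x : x ∈ E⁺(ℚ_{2,2m})} = {s ∈ S : 2^J s = 0, (T·ω̃⁺_{2m})(φ − 1) s = 0}` — annihilation gives `⊆`, and both sides have `2^{J·deg(T·ω̃⁺_{2m})}`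
elements: the right by the cofree count (`X ≃ₗ Λ`), the left by the RANK `deg(T·ω̃⁺_{2m})` of the plus points at even layers
(`exists_indep_signedLocalPoints_even`, `le_ncard_of_indep`). [cite: BDKim2007, Prop. 3.15 (proof, step «Ê(m_n) ⊗ ℚ_p/ℤ_p = H_n[ω_n]»)]
[cite: Kobayashi2003, Thm. 6.2, Prop. 8.12] -/
theorem iota_image_eq_torsionBy_omegaPlus (hss : Rank1Residual.GoodSS W 2) (ha : W.frobeniusTrace 2 = 0)
    {κ : ZpExtension ℚ 2} (hκ : κ.IsCyclotomic) (v : HeightOneSpectrum (𝓞 ℚ)) (hv : (2 : 𝓞 ℚ) ∈ v.asIdeal)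
    {g : Field.absoluteGaloisGroup (v.adicCompletion ℚ)}
    (hg : κ.IsTopGenerator (resGalOfEmb (closureEmb (K := ℚ) (v.adicCompletion ℚ)) g))
    (h : IsDualPair 2 (φ - 1) toDual)
    (ι : ℕ → (↥(⨆ n, signedLocalPoints κ (v.adicCompletion ℚ) W 1 n) →+ S))
    (h0 : ∀ x, ι 0 x = 0) (hsucc : ∀ (k : ℕ) x, 2 • ι (k + 1) x = ι k x)
    (hsurj : ∀ s : S, ∃ (k : ℕ) (x : ↥(⨆ n, signedLocalPoints κ (v.adicCompletion ℚ) W 1 n)), ι k x = s)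
    (hker : ∀ (k : ℕ) (x : ↥(⨆ n, signedLocalPoints κ (v.adicCompletion ℚ) W 1 n)), ι k x = 0 →
      ∃ w : ↥(⨆ n, signedLocalPoints κ (v.adicCompletion ℚ) W 1 n),
        (x : localPoints W (v.adicCompletion ℚ)) = 2 ^ k • (w : localPoints W (v.adicCompletion ℚ)))
    (hequiv : ∀ (k : ℕ) (x : ↥(⨆ n, signedLocalPoints κ (v.adicCompletion ℚ) W 1 n)),
      φ (ι k x) = ι k ⟨g • (x : localPoints W (v.adicCompletion ℚ)), SignedEC.PlusDualTwo.smul_mem_iSup_signedLocalPoints W κ v g x.2⟩)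
    (m J : ℕ) :
    {s : S | ∃ x : ↥(⨆ n, signedLocalPoints κ (v.adicCompletion ℚ) W 1 n),
        (x : localPoints W (v.adicCompletion ℚ)) ∈ signedLocalPoints κ (v.adicCompletion ℚ) W 1 (2 * m) ∧ ι J x = s} =
      {s : S | 2 ^ J • s = 0 ∧ Polynomial.aeval (φ - 1) (X * cyclotomicOmegaPlus 2 (2 * m)) s = 0} := by
  obtain ⟨e⟩ := SignedEC.PlusDualTwo.nonempty_linearEquiv_iwasawaAlgebra_two W hss ha hκ v hv hg h ι h0 hsucc hsurj hker hequiv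
  have hD := (isDistinguishedAt_map_X_mul_cyclotomicOmegaPlus_and_Minus 2 (2 * m)).1
  have hsub := iota_image_subset W hss v hv hg ι h0 hsucc hequiv (2 * m) J
  refine eq_torsionBy_ker_of_subset_of_le_ncard h e hD (span_aeval_X_eq _) (toDual_aeval_X_smul h (X * cyclotomicOmegaPlus 2 (2 * m)))
    J hsub ?_
  -- the rank input
  have hnt : ∀ P ∈ localTowerPointsOfEmb κ (closureEmb (K := ℚ) (v.adicCompletion ℚ)) W, 2 • P = 0 → P = 0 :=
    fun P hP h2 ↦ SSFlatEC.eq_zero_of_mem_localTowerPointsOfEmb_of_two_nsmul W hss κ (by exact_mod_cast hv) _ hP h2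
  obtain ⟨x, hx, hind⟩ := exists_indep_signedLocalPoints_even W hss ha κ hκ v hv m
  have hxA : ∀ i, x i ∈ (⨆ n, signedLocalPoints κ (v.adicCompletion ℚ) W 1 n) := fun i ↦
    (le_iSup (fun n ↦ signedLocalPoints κ (v.adicCompletion ℚ) W 1 n) (2 * m)) (hx i)
  rw [natDegree_map_eq_of_injective (RingHom.injective_int (Int.castRingHom ℤ_[2]))]
  refine le_ncard_of_indep (localTowerPointsOfEmb κ (closureEmb (K := ℚ) (v.adicCompletion ℚ)) W)
    (⨆ n, signedLocalPoints κ (v.adicCompletion ℚ) W 1 n) (SignedEC.PlusDualTwo.iSup_signedLocalPoints_le_localTowerPointsOfEmb W κ v)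
    hnt (ι J) J (hker J) x hxA hind _ ((finite_torsionBy_ker h e hD (span_aeval_X_eq _) _
      (toDual_aeval_X_smul h (X * cyclotomicOmegaPlus 2 (2 * m))) J).subset hsub) fun c hc ↦ ?_
  refine ⟨_, ?_, rfl⟩
  show (∑ i, ((c i : ℕ) : ℤ) • x i) ∈ signedLocalPoints κ (v.adicCompletion ℚ) W 1 (2 * m)
  exact AddSubgroup.sum_mem _ fun i _ ↦ AddSubgroup.zsmul_mem _ (hx i) _

/-- **Kim's step (b)+(c) at `2`: `{ι_J x : x ∈ E⁺(ℚ_{2,2m})} = ω̃⁻_{2m}(φ−1) '' {s : 2^J s = 0, ω_{2m}(φ−1) s = 0}`** — the honest plus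
classes of the even layer `2m` are EXACTLY the image of the layer `S[2^J, ω_{2m}]` under `ω̃⁻_{2m}(φ−1)` (same hypotheses;
`iota_image_eq_torsionBy_omegaPlus` + the cofree instance `image_aeval_cyclotomicOmegaMinus_eq`). This is the input «honest ⊇ ω̃⁻_n·H_n
for even n» of the θ-plan. [cite: BDKim2007, Prop. 3.15 (proof, p. 56)] [cite: Kobayashi2003, Thm. 6.2, Prop. 8.12] -/
theorem iota_image_eq_image_omegaMinus (hss : Rank1Residual.GoodSS W 2) (ha : W.frobeniusTrace 2 = 0)
    {κ : ZpExtension ℚ 2} (hκ : κ.IsCyclotomic) (v : HeightOneSpectrum (𝓞 ℚ)) (hv : (2 : 𝓞 ℚ) ∈ v.asIdeal)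
    {g : Field.absoluteGaloisGroup (v.adicCompletion ℚ)}
    (hg : κ.IsTopGenerator (resGalOfEmb (closureEmb (K := ℚ) (v.adicCompletion ℚ)) g))
    (h : IsDualPair 2 (φ - 1) toDual)
    (ι : ℕ → (↥(⨆ n, signedLocalPoints κ (v.adicCompletion ℚ) W 1 n) →+ S))
    (h0 : ∀ x, ι 0 x = 0) (hsucc : ∀ (k : ℕ) x, 2 • ι (k + 1) x = ι k x)
    (hsurj : ∀ s : S, ∃ (k : ℕ) (x : ↥(⨆ n, signedLocalPoints κ (v.adicCompletion ℚ) W 1 n)), ι k x = s)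
    (hker : ∀ (k : ℕ) (x : ↥(⨆ n, signedLocalPoints κ (v.adicCompletion ℚ) W 1 n)), ι k x = 0 →
      ∃ w : ↥(⨆ n, signedLocalPoints κ (v.adicCompletion ℚ) W 1 n),
        (x : localPoints W (v.adicCompletion ℚ)) = 2 ^ k • (w : localPoints W (v.adicCompletion ℚ)))
    (hequiv : ∀ (k : ℕ) (x : ↥(⨆ n, signedLocalPoints κ (v.adicCompletion ℚ) W 1 n)),
      φ (ι k x) = ι k ⟨g • (x : localPoints W (v.adicCompletion ℚ)), SignedEC.PlusDualTwo.smul_mem_iSup_signedLocalPoints W κ v g x.2⟩)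
    (m J : ℕ) :
    {s : S | ∃ x : ↥(⨆ n, signedLocalPoints κ (v.adicCompletion ℚ) W 1 n),
        (x : localPoints W (v.adicCompletion ℚ)) ∈ signedLocalPoints κ (v.adicCompletion ℚ) W 1 (2 * m) ∧ ι J x = s} =
      (⇑(Polynomial.aeval (φ - 1) (cyclotomicOmegaMinus 2 (2 * m)))) ''
        {s : S | 2 ^ J • s = 0 ∧ Polynomial.aeval (φ - 1) (cyclotomicOmega 2 (2 * m)) s = 0} := by
  obtain ⟨e⟩ := SignedEC.PlusDualTwo.nonempty_linearEquiv_iwasawaAlgebra_two W hss ha hκ v hv hg h ι h0 hsucc hsurj hker hequiv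
  rw [iota_image_eq_torsionBy_omegaPlus W hss ha hκ v hv hg h ι h0 hsucc hsurj hker hequiv m J,
    image_aeval_cyclotomicOmegaMinus_eq h e (2 * m) J]

end Honest

end Summit.BirchSwinnertonDyer.BirchSwinnertonDyer.Theorems.ResidualThetaLayer.PlusDual

end
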